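import Summits.ABC.ABC.Theorems.CongruentialReceptacleTameLocalReceptacleKeyCellDefs
import Literature.NumberTheory.Sieve.SmoothCountLocal
import Literature.NumberTheory.Sieve.SmoothLocalBehaviourHT

/-!
# Crux `TameLocalReceptacle` (stmt-ABC-14354), line `grh-friable-cell-resolution`:
# stub `stub_smoothLocalBehaviour_of_HT` — Hildebrand–Tenenbaum Thm 3 ⟹ `SmoothLocalBehaviour`

Registered stub of the checked skeleton `Cruxes/TameLocalReceptacle/Lines/grh_friable_cell_resolution.lean`
(lead `prover-line-stmt-ABC-14354-a1-0`): `stub_smoothLocalBehaviour_of_HT : Literature.NumberTheory.Sieve.HTLocalBehaviour → SmoothLocalBehaviour`.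
`HTLocalBehaviour` is the NAMED LITERATURE FACT Hildebrand–Tenenbaum, Trans. AMS 296 (1986), Theorem 3 (printed
statement checked against the held copy `paper:doi-10-1090-s0002-9947-1986-0837811-1`, p. 269: "uniformly for
`x ≥ y ≥ 2` and `1 ≤ c ≤ y`, `Ψ(cx, y) = Ψ(x, y) c^{α(x,y)} (1 + O(1/u + (log y)/y))`"), stated here inline (the
gate relocates it to `Literature/NumberTheory/Sieve/SmoothLocalBehaviourHT.lean`); its discharge is the neighbouring
stub `stub_HTLocalBehaviour`.  `SmoothLocalBehaviour` (Defs file `…TameLocalReceptacleKeyCellDefs.lean`): for fixed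
`K, C`, `ε > 0`, all large `x`, all `log x ≤ y ≤ (log x)^K` and all `1 ≤ t ≤ y^C`,
`|Ψ(x/t, y) − t^{−α(x,y)} Ψ(x, y)| ≤ ε t^{−α(x,y)} Ψ(x, y)`.

Proof: put `N = C + 1`, `c = t^{1/N} ∈ [1, y]`, `xᵢ = x/cⁱ` (`x_N = x/t`, `c · x_{i+1} = xᵢ`, and
`y ≤ x/t ≤ xᵢ ≤ x` for large `x` since `y^{C+2} ≤ x` in the polylog regime).  The fact at `(x_{i+1}, y, c)` gives
`|Ψ(xᵢ) − c^{α(x_{i+1})} Ψ(x_{i+1})| ≤ η c^{α(x_{i+1})} Ψ(x_{i+1})`, `η = 3 C₁ K log log x / log x`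
(`C₁ = max(C₀, 1)`; `log y ≤ K log log x`, `log xᵢ ≥ (log x)/2`, `y ≥ log x`), and `α(x) ≤ α(x_{i+1}) ≤ α(x/t)`
(`saddlePoint_antitone`), whence `(1 − η)^N t^{α(x)} Ψ(x/t) ≤ Ψ(x) ≤ (1 + η)^N t^{α(x/t)} Ψ(x/t)`
(`chain_bounds`).  The perturbation `α(x/t) − α(x) ≤ log t/(log 2 · log(x/t))` (`sub_saddlePoint_le_div`: tangent
inequality `saddleSum_sub_mul_le` at `α(x/t)` and `φ₂(σ, y) ≥ log 2 · saddleSum σ y = log 2 · log(x/t)`) gives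
`t^{α(x/t) − α(x)} ≤ exp(ε/4)`; with `N η ≤ ε/4`, `(1 − η)^N ≥ 1 − ε/4`, `(1 + η)^N exp(ε/4) ≤ 1 + ε` (`ε ≤ 1`)
the claim follows.  All thresholds come from the single limit `log² L/L → 0` (`exists_threshold`).
Running log (worker): STEP 0 done (print = rendering); proof complete, no sorry.
-/

-- `Summit.<Summit>.<Problem>` is the mandated summit-side namespace (CONVENTIONS §2); for the
-- single-conjunct summit `ABC` the two coincide, so the duplicate `ABC.ABC` is deliberate.
set_option linter.dupNamespace false

noncomputable section

namespace Summit.ABC.ABC.Theorems.TameLocalReceptacle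

open Finset Filter Topology
open Literature.NumberTheory.Sieve

/-- **`φ₂(σ, y) ≥ log 2 · (−φ₁(σ, y))`** for `σ > 0`: termwise
`log² p · p^σ/(p^σ − 1)² ≥ log 2 · log p/(p^σ − 1)` since `log p ≥ log 2` and `p^σ/(p^σ − 1) ≥ 1`. [folklore] -/
theorem log_two_mul_saddleSum_le_saddlePhi₂ {σ : ℝ} (hσ : 0 < σ) (y : ℕ) :
    Real.log 2 * saddleSum σ y ≤ saddlePhi₂ σ y := by
  rw [saddleSum_def, saddlePhi₂_def, Finset.mul_sum]
  refine Finset.sum_le_sum fun p hp => ?_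
  have hp2 : (2 : ℝ) ≤ p := by exact_mod_cast (Nat.prime_of_mem_primesLE hp).two_le
  have hlog2 : Real.log 2 ≤ Real.log p := Real.log_le_log two_pos hp2
  have hlog0 : 0 ≤ Real.log p := le_trans (Real.log_nonneg one_le_two) hlog2
  set P : ℝ := (p : ℝ) ^ σ with hP
  have hP1 : 1 < P := Real.one_lt_rpow (by linarith) hσ
  have hP1' : 0 < P - 1 := by linarith
  have hkey : Real.log 2 ≤ Real.log p * (P / (P - 1)) := by
    have h1 : 1 ≤ P / (P - 1) := by rw [le_div_iff₀ hP1']; linarith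
    nlinarith [mul_le_mul_of_nonneg_left h1 hlog0]
  calc Real.log 2 * (Real.log p / (P - 1))
      ≤ (Real.log p * (P / (P - 1))) * (Real.log p / (P - 1)) :=
        mul_le_mul_of_nonneg_right hkey (div_nonneg hlog0 hP1'.le)
    _ = Real.log p ^ 2 * (P / (P - 1) ^ 2) := by field_simp

/-- **The saddle points of `x' ≤ x` differ by at most `log(x/x')/(log 2 · log x')`** (`1 < x' ≤ x`, `y ≥ 2`):
the tangent inequality of the convex `−φ₁` at `α' = α(x', y)` gives `φ₂(α', y)(α' − α) ≤ log x − log x'`,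
and `φ₂(α', y) ≥ log 2 · (−φ₁(α', y)) = log 2 · log x'`. [folklore] -/
theorem sub_saddlePoint_le_div {x x' : ℝ} {y : ℕ} (hx' : 1 < x') (hxx' : x' ≤ x) (hy : 2 ≤ y) :
    saddlePoint x' y - saddlePoint x y ≤
      (Real.log x - Real.log x') / (Real.log 2 * Real.log x') := by
  have hx : 1 < x := lt_of_lt_of_le hx' hxx'
  have hα : 0 < saddlePoint x y := saddlePoint_pos hx hy
  have hα' : 0 < saddlePoint x' y := saddlePoint_pos hx' hy
  have ht := saddleSum_sub_mul_le (y := y) (σ := saddlePoint x y) hα' hα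
  have hΦ := log_two_mul_saddleSum_le_saddlePhi₂ hα' y
  rw [saddleSum_saddlePoint hx' hy] at ht hΦ
  rw [saddleSum_saddlePoint hx hy] at ht
  have hd : 0 ≤ saddlePoint x' y - saddlePoint x y := sub_nonneg.2 (saddlePoint_antitone hx' hxx' hy)
  rw [le_div_iff₀ (mul_pos (Real.log_pos one_lt_two) (Real.log_pos hx'))]
  calc (saddlePoint x' y - saddlePoint x y) * (Real.log 2 * Real.log x')
      ≤ (saddlePoint x' y - saddlePoint x y) * saddlePhi₂ (saddlePoint x' y) y :=
        mul_le_mul_of_nonneg_left hΦ hd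
    _ ≤ Real.log x - Real.log x' := by linarith

/-- If `a f(i+1) ≤ f(i) ≤ b f(i+1)` for `i < n` (`a, b ≥ 0`), then `aⁿ f(n) ≤ f(0) ≤ bⁿ f(n)`. [folklore] -/
theorem chain_bounds (f : ℕ → ℝ) {a b : ℝ} (ha : 0 ≤ a) (hb : 0 ≤ b) :
    ∀ n : ℕ, (∀ i < n, a * f (i + 1) ≤ f i ∧ f i ≤ b * f (i + 1)) →
      a ^ n * f n ≤ f 0 ∧ f 0 ≤ b ^ n * f n
  | 0, _ => by simp
  | n + 1, h => by
      obtain ⟨h1, h2⟩ := chain_bounds f ha hb n fun i hi => h i (Nat.lt_succ_of_lt hi)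
      obtain ⟨h3, h4⟩ := h n (Nat.lt_succ_self n)
      constructor
      · calc a ^ (n + 1) * f (n + 1) = a ^ n * (a * f (n + 1)) := by ring
          _ ≤ a ^ n * f n := mul_le_mul_of_nonneg_left h3 (pow_nonneg ha n)
          _ ≤ f 0 := h1
      · calc f 0 ≤ b ^ n * f n := h2
          _ ≤ b ^ n * (b * f (n + 1)) := mul_le_mul_of_nonneg_left h4 (pow_nonneg hb n)
          _ = b ^ (n + 1) * f (n + 1) := by ring

/-- **The threshold in `L = log x`.** For `A ≥ 0`, `C₁ ≥ 1`, `0 < ε ≤ 1` there is `L₀` such that for `L ≥ L₀`: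
`L ≥ 4`, `log L ≥ 1`, `2A log L ≤ L`, `12 C₁ A log L ≤ ε L` and `8 A² log² L ≤ ε log 2 · L`
(all from `log² L / L → 0`). [folklore] -/
theorem exists_threshold {A C₁ ε : ℝ} (hA : 0 ≤ A) (hC₁ : 1 ≤ C₁) (hε : 0 < ε) (hε1 : ε ≤ 1) :
    ∃ L₀ : ℝ, ∀ L : ℝ, L₀ ≤ L → 4 ≤ L ∧ 1 ≤ Real.log L ∧ 2 * A * Real.log L ≤ L ∧
      12 * C₁ * A * Real.log L ≤ ε * L ∧ 8 * A ^ 2 * Real.log L ^ 2 ≤ ε * Real.log 2 * L := by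
  have hC₁0 : 0 < C₁ := by linarith
  have h1 : Tendsto (fun L : ℝ => Real.log L ^ 2 / (1 * L + 0)) atTop (𝓝 0) :=
    Real.tendsto_pow_log_div_mul_add_atTop 1 0 2 one_ne_zero
  have hD0 : 0 < 16 * (A + 1) ^ 2 * C₁ := by positivity
  obtain ⟨L₀, hL₀⟩ := Filter.eventually_atTop.1
    ((h1.eventually (ge_mem_nhds (div_pos hε hD0))).and (eventually_ge_atTop (Real.exp 4)))
  refine ⟨L₀, fun L hL => ?_⟩
  obtain ⟨hLM, hL4⟩ := hL₀ L hL
  have hL4' : 4 ≤ L := le_trans (by linarith [Real.add_one_le_exp (4 : ℝ)]) hL4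
  have hL0 : 0 < L := by linarith
  have hlogL : 4 ≤ Real.log L := by
    have := Real.log_le_log (Real.exp_pos 4) hL4
    rwa [Real.log_exp] at this
  have hl0 : 0 ≤ Real.log L := by linarith
  rw [one_mul, add_zero, div_le_div_iff₀ hL0 hD0] at hLM
  have hεL : ε * L ≤ L := mul_le_of_le_one_left hL0.le hε1
  have hll : Real.log L ≤ Real.log L ^ 2 := by nlinarith
  have hAℓ : A * Real.log L ≤ (A + 1) ^ 2 * Real.log L ^ 2 :=
    mul_le_mul (by nlinarith) hll hl0 (by positivity)
  have hC₁ℓ : (A + 1) ^ 2 * Real.log L ^ 2 ≤ (A + 1) ^ 2 * C₁ * Real.log L ^ 2 := by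
    nlinarith [mul_le_mul_of_nonneg_left hC₁ (by positivity : 0 ≤ (A + 1) ^ 2 * Real.log L ^ 2)]
  refine ⟨hL4', by linarith, by nlinarith, ?_, ?_⟩
  · nlinarith [mul_le_mul_of_nonneg_left hAℓ hC₁0.le, mul_pos hε hL0]
  · have h2 : A ^ 2 * Real.log L ^ 2 ≤ (A + 1) ^ 2 * C₁ * Real.log L ^ 2 :=
      mul_le_mul_of_nonneg_right
        (by nlinarith [mul_le_mul_of_nonneg_left hC₁ (sq_nonneg (A + 1))]) (sq_nonneg _)
    have h3 : ε * L * (1 / 2) ≤ ε * L * Real.log 2 :=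
      mul_le_mul_of_nonneg_left (by linarith [Real.log_two_gt_d9]) (mul_pos hε hL0).le
    nlinarith

/-- `(1 − η)^N ≥ 1 − ε/4` and `(1 + η)^N e^{ε/4} ≤ 1 + ε` for `0 ≤ η ≤ 1`, `N η ≤ ε/4`, `0 < ε ≤ 1`
(Bernoulli, `1 + η ≤ e^η`, `e^{ε/2} ≤ 1 + ε/2 + ε²/4`). [folklore] -/
theorem pow_bounds_of_mul_le {η ε : ℝ} {N : ℕ} (hη : 0 ≤ η) (hη1 : η ≤ 1) (hNη : (N : ℝ) * η ≤ ε / 4)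
    (hε : 0 < ε) (hε1 : ε ≤ 1) :
    1 - ε / 4 ≤ (1 - η) ^ N ∧ (1 + η) ^ N * Real.exp (ε / 4) ≤ 1 + ε := by
  constructor
  · have h := one_add_mul_le_pow (show (-2 : ℝ) ≤ -η by linarith) N
    rw [← sub_eq_add_neg] at h
    linarith
  · have h1 : (1 + η) ^ N ≤ Real.exp (ε / 4) :=
      calc (1 + η) ^ N ≤ Real.exp η ^ N :=
            pow_le_pow_left₀ (by linarith) (by linarith [Real.add_one_le_exp η]) N
        _ = Real.exp (N * η) := (Real.exp_nat_mul η N).symm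
        _ ≤ Real.exp (ε / 4) := Real.exp_le_exp.2 hNη
    have h2 : Real.exp (ε / 4) * Real.exp (ε / 4) ≤ 1 + ε := by
      rw [← Real.exp_add]
      have h := Real.abs_exp_sub_one_sub_id_le
        (show |ε / 4 + ε / 4| ≤ 1 by rw [abs_le]; constructor <;> linarith)
      nlinarith [(abs_le.1 h).2, mul_le_mul_of_nonneg_left hε1 hε.le]
    calc (1 + η) ^ N * Real.exp (ε / 4) ≤ Real.exp (ε / 4) * Real.exp (ε / 4) :=
          mul_le_mul_of_nonneg_right h1 (Real.exp_nonneg _)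
      _ ≤ 1 + ε := h2

/-- **Final bookkeeping**: `(1 − ε/4) T Q ≤ P ≤ (1 + ε) T Q` (`T > 0`, `Q ≥ 0`, `0 < ε ≤ 1`) gives the relative
error `|Q − T⁻¹ P| ≤ ε T⁻¹ P`. [folklore] -/
theorem abs_sub_le_of_two_sided {P Q T ε : ℝ} (hT : 0 < T) (hQ : 0 ≤ Q) (hε : 0 < ε) (hε1 : ε ≤ 1)
    (hlow : (1 - ε / 4) * (T * Q) ≤ P) (hupp : P ≤ (1 + ε) * (T * Q)) :
    |Q - T⁻¹ * P| ≤ ε * (T⁻¹ * P) := by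
  have hTQ : 0 ≤ T * Q := by positivity
  have hTne : T ≠ 0 := hT.ne'
  have key : |T * Q - P| ≤ ε * P := by
    rw [abs_sub_le_iff]
    constructor
    · linarith [mul_nonneg (sub_nonneg.2 hlow) (by linarith : (0 : ℝ) ≤ 1 + ε),
        mul_nonneg (mul_nonneg hTQ hε.le) (by linarith : (0 : ℝ) ≤ 3 - ε)]
    · linarith [mul_le_mul_of_nonneg_left hupp (sub_nonneg.2 hε1),
        mul_nonneg (mul_nonneg hε.le hε.le) hTQ]
  have hrw : Q - T⁻¹ * P = T⁻¹ * (T * Q - P) := by field_simp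
  rw [hrw, abs_mul, abs_of_pos (inv_pos.2 hT)]
  calc T⁻¹ * |T * Q - P| ≤ T⁻¹ * (ε * P) := mul_le_mul_of_nonneg_left key (inv_pos.2 hT).le
    _ = ε * (T⁻¹ * P) := by ring

/-- **Main lemma**: `HTLocalBehaviour` gives `SmoothLocalBehaviour` for `ε ≤ 1` (iteration of the fact along
`x/t = x_N ≤ … ≤ x₁ ≤ x₀ = x`, `xᵢ = x/cⁱ`, `c = t^{1/N}`, `N = C + 1`, plus the saddle-point perturbation).
[folklore] -/
theorem smoothLocalBehaviour_aux (hHT : Literature.NumberTheory.Sieve.HTLocalBehaviour) (K C : ℕ) {ε : ℝ} (hε : 0 < ε)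
    (hε1 : ε ≤ 1) :
    ∃ x₀ : ℝ, ∀ x : ℝ, x₀ ≤ x → ∀ y : ℕ,
      Real.log x ≤ (y : ℝ) → (y : ℝ) ≤ Real.log x ^ K → ∀ t : ℝ, 1 ≤ t → t ≤ (y : ℝ) ^ C →
        |((Nat.smoothNumbersUpTo ⌊x / t⌋₊ (y + 1)).card : ℝ) -
            t ^ (-(saddlePoint x y)) * ((Nat.smoothNumbersUpTo ⌊x⌋₊ (y + 1)).card : ℝ)| ≤
          ε * (t ^ (-(saddlePoint x y)) * ((Nat.smoothNumbersUpTo ⌊x⌋₊ (y + 1)).card : ℝ)) := by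
  obtain ⟨C₀, hHT⟩ := hHT
  set C₁ : ℝ := max C₀ 1 with hC₁
  have hC₁1 : 1 ≤ C₁ := le_max_right _ _
  have hC₁0 : 0 < C₁ := by linarith only [hC₁1]
  have hC₀C₁ : C₀ ≤ C₁ := le_max_left _ _
  set N : ℕ := C + 1 with hN
  have hN0 : N ≠ 0 := by omega
  have hNr1 : (1 : ℝ) ≤ N := by exact_mod_cast (show 1 ≤ N by omega)
  set A : ℝ := (N : ℝ) * K with hA
  have hA0 : 0 ≤ A := by rw [hA]; positivity
  obtain ⟨L₀, hL₀⟩ := exists_threshold hA0 hC₁1 hε hε1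
  refine ⟨Real.exp L₀, fun x hx y hyL hyK t ht1 htC => ?_⟩
  have hx0 : 0 < x := lt_of_lt_of_le (Real.exp_pos _) hx
  set L : ℝ := Real.log x with hLdef
  obtain ⟨hL4, hlogL1, c1, c3, c4⟩ := hL₀ L (by
    have := Real.log_le_log (Real.exp_pos _) hx
    rwa [Real.log_exp] at this)
  have hL0 : 0 < L := by linarith only [hL4]
  have hLne : L ≠ 0 := hL0.ne'
  have hlogL0 : 0 ≤ Real.log L := by linarith only [hlogL1]
  have hlog2 : 0 < Real.log 2 := Real.log_pos one_lt_two
  have hx1 : 1 < x := by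
    by_contra h
    have h' : L ≤ 0 := Real.log_nonpos hx0.le (not_lt.1 h)
    linarith only [h', hL0]
  have hy2r : (2 : ℝ) ≤ y := by linarith only [hL4, hyL]
  have hy2 : 2 ≤ y := by exact_mod_cast hy2r
  have hy0 : (0 : ℝ) < y := by linarith only [hy2r]
  have hy1 : (1 : ℝ) ≤ y := by linarith only [hy2r]
  have hlogy0 : 0 ≤ Real.log y := Real.log_nonneg hy1
  have hlogyK : Real.log y ≤ K * Real.log L := by
    have := Real.log_le_log hy0 hyK
    rwa [Real.log_pow] at this
  have hKℓ0 : 0 ≤ (K : ℝ) * Real.log L := by positivity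
  have ht0 : 0 < t := by linarith only [ht1]
  have htN : t ≤ (y : ℝ) ^ N := htC.trans (pow_le_pow_right₀ hy1 (by omega))
  have hlogt0 : 0 ≤ Real.log t := Real.log_nonneg ht1
  have hNlogy : (N : ℝ) * Real.log y ≤ A * Real.log L :=
    calc (N : ℝ) * Real.log y ≤ N * (K * Real.log L) :=
          mul_le_mul_of_nonneg_left hlogyK (Nat.cast_nonneg _)
      _ = A * Real.log L := by rw [hA]; ring
  have hlogt : Real.log t ≤ A * Real.log L := by
    have h1 := Real.log_le_log ht0 htN
    rw [Real.log_pow] at h1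
    exact h1.trans hNlogy
  have hyt : (y : ℝ) * t ≤ x := by
    have h2 : Real.log ((y : ℝ) ^ (N + 1)) ≤ L := by
      rw [Real.log_pow]
      push_cast
      have := le_mul_of_one_le_left hlogy0 hNr1
      linarith only [this, hNlogy, c1]
    have h3 : (y : ℝ) ^ (N + 1) ≤ x := by
      rw [← Real.exp_log (by positivity : (0 : ℝ) < (y : ℝ) ^ (N + 1)), ← Real.exp_log hx0]
      exact Real.exp_le_exp.2 h2
    calc (y : ℝ) * t ≤ (y : ℝ) * (y : ℝ) ^ N := mul_le_mul_of_nonneg_left htN hy0.le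
      _ = (y : ℝ) ^ (N + 1) := by ring
      _ ≤ x := h3
  have hyxt : (y : ℝ) ≤ x / t := by rw [le_div_iff₀ ht0]; exact hyt
  have hxt1 : 1 < x / t := by linarith only [hy2r, hyxt]
  have hxt0 : 0 < x / t := by linarith only [hxt1]
  have hxtx : x / t ≤ x := div_le_self hx0.le ht1
  have hlogxt : L / 2 ≤ Real.log (x / t) := by
    rw [Real.log_div hx0.ne' ht0.ne', ← hLdef]
    linarith only [hlogt, c1]
  -- ### the step `c = t^{1/N}` and the points `xᵢ = x / cⁱ`
  set c : ℝ := t ^ ((N : ℝ)⁻¹) with hcdef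
  have hc1 : 1 ≤ c := Real.one_le_rpow ht1 (by positivity)
  have hc0 : 0 < c := by linarith only [hc1]
  have hcN : c ^ N = t := Real.rpow_inv_natCast_pow ht0.le hN0
  have hcy : c ≤ y :=
    calc c ≤ ((y : ℝ) ^ N) ^ ((N : ℝ)⁻¹) := Real.rpow_le_rpow ht0.le htN (by positivity)
      _ = y := Real.pow_rpow_inv_natCast hy0.le hN0
  have hxi_ge : ∀ i, i ≤ N → x / t ≤ x / c ^ i := fun i hi => by
    rw [← hcN]
    exact div_le_div_of_nonneg_left hx0.le (pow_pos hc0 i) (pow_le_pow_right₀ hc1 hi)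
  set α : ℝ := saddlePoint x y with hαdef
  set α' : ℝ := saddlePoint (x / t) y with hα'def
  set η : ℝ := 3 * C₁ * K * Real.log L / L with hηdef
  have hη0 : 0 ≤ η := by positivity
  have hNη : (N : ℝ) * η ≤ ε / 4 := by
    have h1 : (N : ℝ) * η = 3 * C₁ * A * Real.log L / L := by rw [hηdef, hA]; ring
    rw [h1, div_le_iff₀ hL0]
    linarith only [c3]
  have hη1 : η ≤ 1 := by
    have := le_mul_of_one_le_left hη0 hNr1
    linarith only [this, hNη, hε1]
  -- ### the one-step inequalities
  set a : ℝ := (1 - η) * c ^ α with hadef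
  set b : ℝ := (1 + η) * c ^ α' with hbdef
  have ha0 : 0 ≤ a := mul_nonneg (by linarith only [hη1]) (Real.rpow_nonneg hc0.le _)
  have hb0 : 0 ≤ b := mul_nonneg (by linarith only [hη0]) (Real.rpow_nonneg hc0.le _)
  have hstep : ∀ i < N,
      a * ((Nat.smoothNumbersUpTo ⌊x / c ^ (i + 1)⌋₊ (y + 1)).card : ℝ) ≤
          ((Nat.smoothNumbersUpTo ⌊x / c ^ i⌋₊ (y + 1)).card : ℝ) ∧
        ((Nat.smoothNumbersUpTo ⌊x / c ^ i⌋₊ (y + 1)).card : ℝ) ≤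
          b * ((Nat.smoothNumbersUpTo ⌊x / c ^ (i + 1)⌋₊ (y + 1)).card : ℝ) := by
    intro i hi
    have hx'ge : x / t ≤ x / c ^ (i + 1) := hxi_ge (i + 1) (Nat.succ_le_of_lt hi)
    have hx'le : x / c ^ (i + 1) ≤ x := div_le_self hx0.le (one_le_pow₀ hc1)
    have hcx' : c * (x / c ^ (i + 1)) = x / c ^ i := by
      rw [eq_div_iff (pow_pos hc0 i).ne', pow_succ]
      field_simp
    generalize x / c ^ (i + 1) = x' at hx'ge hx'le hcx' ⊢
    have hx'1 : 1 < x' := lt_of_lt_of_le hxt1 hx'ge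
    have hyx' : (y : ℝ) ≤ x' := hyxt.trans hx'ge
    have hH := hHT x' y hy2 hyx' c hc1 hcy
    rw [hcx'] at hH
    set F' : ℝ := ((Nat.smoothNumbersUpTo ⌊x'⌋₊ (y + 1)).card : ℝ) with hF'
    set W : ℝ := c ^ saddlePoint x' y * F' with hW
    have hF'0 : 0 ≤ F' := Nat.cast_nonneg _
    have hW0 : 0 ≤ W := mul_nonneg (Real.rpow_nonneg hc0.le _) hF'0
    have hlogx' : L / 2 ≤ Real.log x' := hlogxt.trans (Real.log_le_log hxt0 hx'ge)
    have hlogx'0 : 0 < Real.log x' := by linarith only [hL0, hlogx']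
    have herr : C₀ * (Real.log y / Real.log x' + Real.log y / y) ≤ η := by
      have h1 : Real.log y / Real.log x' ≤ K * Real.log L / (L / 2) :=
        div_le_div₀ hKℓ0 hlogyK (by linarith only [hL0]) hlogx'
      have h2 : Real.log y / y ≤ K * Real.log L / L := div_le_div₀ hKℓ0 hlogyK hL0 hyL
      calc C₀ * (Real.log y / Real.log x' + Real.log y / y)
          ≤ C₁ * (K * Real.log L / (L / 2) + K * Real.log L / L) :=
            mul_le_mul hC₀C₁ (add_le_add h1 h2) (by positivity) hC₁0.le
        _ = η := by rw [hηdef]; field_simp; ring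
    obtain ⟨hlo, hhi⟩ := abs_sub_le_iff.1 (hH.trans (mul_le_mul_of_nonneg_right herr hW0))
    have hcα : c ^ α ≤ c ^ saddlePoint x' y :=
      Real.rpow_le_rpow_of_exponent_le hc1 (saddlePoint_antitone hx'1 hx'le hy2)
    have hcα' : c ^ saddlePoint x' y ≤ c ^ α' :=
      Real.rpow_le_rpow_of_exponent_le hc1 (saddlePoint_antitone hxt1 hx'ge hy2)
    constructor
    · calc a * F' = (1 - η) * (c ^ α * F') := by rw [hadef]; ring
        _ ≤ (1 - η) * W :=
            mul_le_mul_of_nonneg_left (mul_le_mul_of_nonneg_right hcα hF'0) (by linarith only [hη1])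
        _ ≤ _ := by linarith only [hhi]
    · calc _ ≤ (1 + η) * W := by linarith only [hlo]
        _ ≤ (1 + η) * (c ^ α' * F') :=
            mul_le_mul_of_nonneg_left (mul_le_mul_of_nonneg_right hcα' hF'0) (by linarith only [hη0])
        _ = b * F' := by rw [hbdef]; ring
  -- ### the chain from `x₀ = x` down to `x_N = x / t`
  have hchain := chain_bounds (fun i => ((Nat.smoothNumbersUpTo ⌊x / c ^ i⌋₊ (y + 1)).card : ℝ))
    ha0 hb0 N hstep
  simp only [pow_zero, div_one, hcN] at hchain
  obtain ⟨hlow, hupp⟩ := hchain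
  set P : ℝ := ((Nat.smoothNumbersUpTo ⌊x⌋₊ (y + 1)).card : ℝ) with hPdef
  set Q : ℝ := ((Nat.smoothNumbersUpTo ⌊x / t⌋₊ (y + 1)).card : ℝ) with hQdef
  have hQ0 : 0 ≤ Q := Nat.cast_nonneg _
  set T : ℝ := t ^ α with hTdef
  have hT0 : 0 < T := Real.rpow_pos_of_pos ht0 _
  rw [hadef, mul_pow, Real.rpow_pow_comm hc0.le, hcN, ← hTdef] at hlow
  rw [hbdef, mul_pow, Real.rpow_pow_comm hc0.le, hcN] at hupp
  -- ### the saddle-point perturbation `t^{α'} ≤ exp(ε/4) t^{α}`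
  have hpert : t ^ α' ≤ Real.exp (ε / 4) * T := by
    have hd := sub_saddlePoint_le_div hxt1 hxtx hy2
    rw [← hα'def, ← hαdef, Real.log_div hx0.ne' ht0.ne', ← hLdef, sub_sub_cancel] at hd
    have hden0 : 0 < Real.log 2 * (L / 2) := by positivity
    have hden : Real.log 2 * (L / 2) ≤ Real.log 2 * (L - Real.log t) :=
      mul_le_mul_of_nonneg_left (by linarith only [hlogt, c1]) hlog2.le
    have hkey : (α' - α) * Real.log t ≤ ε / 4 := by
      have h1 : (α' - α) * Real.log t ≤
          A * Real.log L / (Real.log 2 * (L / 2)) * (A * Real.log L) :=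
        calc (α' - α) * Real.log t
            ≤ Real.log t / (Real.log 2 * (L - Real.log t)) * Real.log t :=
              mul_le_mul_of_nonneg_right hd hlogt0
          _ ≤ A * Real.log L / (Real.log 2 * (L / 2)) * (A * Real.log L) :=
              mul_le_mul (div_le_div₀ (by positivity) hlogt hden0 hden) hlogt hlogt0 (by positivity)
      have h2 : A * Real.log L / (Real.log 2 * (L / 2)) * (A * Real.log L) ≤ ε / 4 := by
        rw [div_mul_eq_mul_div, div_le_div_iff₀ hden0 (by norm_num : (0 : ℝ) < 4)]
        linarith only [c4]
      exact h1.trans h2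
    calc t ^ α' = t ^ (α' - α) * T := by rw [hTdef, ← Real.rpow_add ht0, sub_add_cancel]
      _ ≤ Real.exp (ε / 4) * T := by
          refine mul_le_mul_of_nonneg_right ?_ hT0.le
          rw [Real.rpow_def_of_pos ht0, Real.exp_le_exp]
          linarith only [hkey]
  obtain ⟨hbern, hexp⟩ := pow_bounds_of_mul_le hη0 hη1 hNη hε hε1
  rw [Real.rpow_neg ht0.le α, ← hTdef]
  refine abs_sub_le_of_two_sided hT0 hQ0 hε hε1 ?_ ?_
  · calc (1 - ε / 4) * (T * Q) ≤ (1 - η) ^ N * (T * Q) :=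
          mul_le_mul_of_nonneg_right hbern (by positivity)
      _ = (1 - η) ^ N * T * Q := by ring
      _ ≤ P := hlow
  · calc P ≤ (1 + η) ^ N * t ^ α' * Q := hupp
      _ ≤ (1 + η) ^ N * (Real.exp (ε / 4) * T) * Q :=
          mul_le_mul_of_nonneg_right
            (mul_le_mul_of_nonneg_left hpert (pow_nonneg (by linarith only [hη0]) N)) hQ0
      _ = (1 + η) ^ N * Real.exp (ε / 4) * (T * Q) := by ring
      _ ≤ (1 + ε) * (T * Q) := mul_le_mul_of_nonneg_right hexp (by positivity)

/-- **Registered stub** `stub_smoothLocalBehaviour_of_HT` of line `grh-friable-cell-resolution`: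
Hildebrand–Tenenbaum's Theorem 3 (the named fact `HTLocalBehaviour`) implies the line's currency
`SmoothLocalBehaviour` (local behaviour `Ψ(x/t, y) ∼ t^{−α(x,y)} Ψ(x, y)`, `t ≤ y^C`, polylog regime).
[cite: HildebrandTenenbaum1986, Thm 3] -/
theorem stub_smoothLocalBehaviour_of_HT : Literature.NumberTheory.Sieve.HTLocalBehaviour → SmoothLocalBehaviour := by
  intro hHT K C ε hε
  obtain ⟨x₀, h⟩ := smoothLocalBehaviour_aux hHT K C (lt_min hε one_pos) (min_le_right ε 1)
  refine ⟨x₀, fun x hx y hy1 hy2 t ht1 ht2 => (h x hx y hy1 hy2 t ht1 ht2).trans ?_⟩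
  exact mul_le_mul_of_nonneg_right (min_le_left ε 1)
    (mul_nonneg (Real.rpow_nonneg (by linarith) _) (Nat.cast_nonneg _))

end Summit.ABC.ABC.Theorems.TameLocalReceptacle

end
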